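import Literature.MathematicalPhysics.QuantumFieldTheory.BalabanImbrieJaffe1984to88.BIJ88Eq596Sectors
import Literature.MathematicalPhysics.QuantumFieldTheory.BalabanImbrieJaffe1984to88.BIJ88Sect5StatementsPart4

/-!
# `BalabanImbrieJaffe1984to88.BIJ88Eq596Insertions` — T. Bałaban, J. Imbrie, A. Jaffe, *Effective action and cluster properties of the
abelian Higgs model*, Commun. Math. Phys. **114** (1988) 257–315 [BalabanImbrieJaffe1988], Sect. 5.9 p. 297 [PDF 41]: *"These bounds allow
us to insert the following characteristic functions: χ_{k+1,Λ₀^{(k)′}} = Π_{p∈Λ₀^{(k)′**}} χ(ce_kp(e_k), |v(p) − 1|) × Π_{y∈Λ₀^{(k)′}} χ(cp(e_k)λ_k^{−1/4},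
|ψ(y)|) Π_{b∈Λ₀^{(k)′*}} χ(cp(e_k), |(D_{ū_{k+1}}ψ)(b)|) and the integral is unchanged. … The bounds (5.9.4), (5.9.5) allow us to insert the
characteristic functions χ′_{Λ₇^{(k)}} = Π_{b∈Λ₇^{(k)*}} χ(cp(e_k), A^{(k)}) Π_{x∈Λ₇^{(k)}} χ(cp(e_k), φ^{(k)}) without changing anything. We note that the
restrictions implied by χ_{Λ₀^{(k)}} are stronger than the corresponding restrictions in χ_{k,Λ₀^{(k−1)′}} in Λ₁^{(k)}. … Thus we can replace
χ_{k,Λ₀^{(k−1)′}} with χ_{k,Λ₀^{(k−1)′}∩Λ₁^{(k)c}} without changing anything."* — **THE SECTOR (C) OF `h59`: THE CHARACTERISTIC-FUNCTION ENTRY OF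
(5.9.6) FROM THE THREE INSERTION SENTENCES, WITH THE PRINTED INSERTED FUNCTIONS OF RECORD.**

statement-level skeleton of published theorems with citation tags; proofs where landed; nothing here is a claim about the Yang–Mills mass gap

WHAT THIS FILE DOES (row `C2.Eq5.9.6` of `HOME/lit-balaban-r16/ROWS-C2-part2.md`, owner r16; the flip test of record (ROWS v2.154) lists four
displayed items of this seat's `BIJ88Eq596Sectors.eq596_of_sectors_filled`, the fourth being (C) `hins`, *"fed from rows 5.9.1-5.9.5"*).  In
`BIJ88Eq596Sectors` the sector (C) consists of two displayed hypotheses: `hchars` (the (5.9.6) entry `chars` is `ζχ·χ_k` — the (5.2.8)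
characteristic functions read at the original variables — times an inserted factor `χ_ins`) and `hins` (`χ_ins = 1` wherever `ζχ·χ_k ≠ 0`, on
axial-gauge configurations).  Here:
* §1 `chiNext_eq_one` — r16's PRINTED inserted function `χ_{k+1,Λ₀^{(k)′}}` (`BIJ88Sect5StatementsPart4.chiNext`, with body, both regimes of
  (5.9.2)) equals `1` on configurations obeying the bounds strictly inside the plateau of the profile (r16's `cutoff_eq_one`: `χ(p, x) = 1` for
  `|x| ≤ (9/10)p`, the printed plateau of (5.2.3)); the companion `chiPrime7_eq_one` for `χ′_{Λ₇^{(k)}}` is r16's; `norm_v_sub_one_le_of_591`: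
  (5.9.1) as printed (`|f(p)| ≤ cp(e_k)`, `v(p) = e^{ie_kf(p)}`) gives `|v(p) − 1| ≤ e_k·cp(e_k)`.
* §2 `InsertionReading` (the regions `Λ₀^{(k)′}`, `Λ₇^{(k)}` of the term, the constants `c, e_k, p(e_k), λ_k, λ, L^kε`, the profile `χ`, and
  the readings of `v(p)`, of the bond products `ū_{k+1}` of (4.4) at `k+1` and of `A^{(k)}_b` — the arguments the printed functions take) and
  **`chiIns`** := `χ_{k+1,Λ₀^{(k)′}} · χ′_{Λ₇^{(k)}}` (r16's `chiNext · chiPrime7` at the read arguments) — the inserted factor OF RECORD.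
* §3 **`hins_of_bounds`**: the hypothesis `hins` of `BIJ88Eq596Sectors.h59_of_sectors`/`eq596_of_sectors(_filled)` HOLDS for `χ_ins := chiIns`
  provided the printed bounds hold on the support of `ζχ·χ_k` (axial gauge), strictly inside the plateaux: (5.9.1) in the form the inserted
  function takes it, `|v(p) − 1| ≤ (9/10)·ce_kp(e_k)` on `Λ₀^{(k)′**}` (*"the restrictions on u(p) and the gauge field renormalization
  transformations imply"*); (5.9.2) on `Λ₀^{(k)′}` (both regimes); (5.9.3) `|(D_{ū_{k+1}}ψ)(b)| ≤ (9/10)·cp(e_k)` on `Λ₀^{(k)′*}`; (5.9.4) `|A^{(k)}_b| ≤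
  (9/10)·cp(e_k)` on `Λ₇^{(k)*}`; (5.9.5) `|φ^{(k)}(x)| ≤ (9/10)·cp(e_k)` on `Λ₇^{(k)}` — DISPLAYED hypotheses in the shapes of rows C2.Eq5.9.1-5.9.2,
  C2.Eq5.9.3, C2.Eq5.9.4-5.9.5 (whose theorems of record — p02's `BIJ88Ineq593Proof`, `BIJ88Ineq594Proof`, `BIJ88Ineq595Proof`, p31's
  `BIJ88Eq531SmallAPrime` — are what feeds them; the `9/10` is the PRINTED plateau of (5.2.3) p. 278, *"equal to one for |x| ≤ 9/10"*, the
  printed radii and the printed bounds each carrying a generic constant `c`); `norm_v_sub_one_le_of_591` records how (5.9.1) as printed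
  (`|(1/(ie_k)) log v(p)| = |f(p)| ≤ cp(e_k)`) bounds the argument `|v(p) − 1|` of the first inserted factor (`|e^{iθ} − 1| ≤ |θ|`).
* §4 **`hchars_of_split`**: the hypothesis `hchars` HOLDS for the (5.9.6) entry `chars := ζχ · χ_{k,Λ₀^{(k−1)′}∩Λ₁^{(k)c}} · chiIns` provided the
  (4.1) characteristic function splits as `χ_{k,Λ₀^{(k−1)′}} = χ_{k,·∩Λ₁^{(k)}} · χ_{k,·∩Λ₁^{(k)c}}` (a reading of the product (4.5)) and the `Λ₁^{(k)}`-part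
  equals `1` wherever `ζχ ≠ 0` (the third sentence: *"the restrictions implied by χ_{Λ₀^{(k)}} are stronger"* — DISPLAYED).
* §5 `eq596_of_sectors_ins`: `BIJ88Eq596Sectors.eq596_of_sectors_filled` with `χ_ins := chiIns` and `hins` discharged by §3 — (5.9.6) at measure
  level with the sector (C) carried by the printed bounds; left displayed: (G) `hG`, (S) `hS`, (Z) `hZ` (fed by name modulo readings in this
  seat's `BIJ88Eq596SlotsByName`), the five bounds, the `Λ₁`-part claim.

HONEST SCOPE.  No bound is proved here: (5.9.1)–(5.9.5) enter as displayed hypotheses on the support; the readings (`v(p)`, `ū_{k+1}`, `A^{(k)}`)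
are DATA.  Definitions with bodies (`InsertionReading`, `chiIns`, `charsNew`) and theorems; 0 `sorry`; NO `Prop`-valued fact; imports this
seat's `BIJ88Eq596Sectors` and r16's `BIJ88Sect5StatementsPart4` (Literature + Mathlib); standard axioms.  Page 297 [PDF 41] re-read as an image
this session (r16's render `original-p041-x2.png`).  Seat p34 gen 13 (unit `lit-balaban-p34-g13`; TAKING line HOME/STATUS.md 2026-08-22T12:11:44Z).
-/

namespace Literature.MathematicalPhysics.QuantumFieldTheory.BalabanImbrieJaffe1984to88.BIJ88Eq596Insertions

open Literature.MathematicalPhysics.QuantumFieldTheory.Balaban1983to89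
open BIJ88Sect3Statements (U1 cfg covD starB starP)
open BIJ85Sect1Model (HiggsField)
open BIJ88Sect5Statements (CutoffProfile cutoff cutoff_eq_one)
open BIJ88Sect5StatementsPart4 (chiNext chiPrime7 chiPrime7_eq_one)
open BIJ88RenormTransf311 (axialMeasure axialBonds gaussWeight DeltaAx)
open BIJ88InductiveForm41 (Prev Term41 gaugeForm scalarForm)
open BIJ85BlockAveragesTorus (qU)
open BIJ88RT52Restrictions (Fields fieldsMeasure IsRD)
open BIJ88Eq596Display (uCut IsDT)
open BIJ88RT552Transl (bondMul)
open BIJ88Eq596Frame (Entry Bracket596 bracket596)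
open BIJ88Eq596Density (rho596 renamedBracket)
open BIJ88Eq596Sectors (uOrig phiOrig psiOrig rho528 gaussQuad fill41 eq596_of_sectors_filled)
open scoped BigOperators
open _root_.MeasureTheory

noncomputable section

variable {P : Params} {k : ℕ}

/-! ## §1 The printed `χ_{k+1,Λ₀^{(k)′}}` equals `1` strictly inside its plateaux -/

/-- **`χ_{k+1,Λ₀^{(k)′}} = 1` on configurations obeying (5.9.1)–(5.9.3) strictly inside the plateaux** — the sense of *"and the integral is
unchanged"* (p. 297) for such configurations: each factor `χ(p, x)` of r16's `chiNext` is `1` when `|x| ≤ (9/10)p` (`cutoff_eq_one`), in both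
regimes `(L^kε)^d < λ` / `(L^kε)^d ≥ λ` of (5.9.2). [cite: BalabanImbrieJaffe1988, (5.9.3) p.297] -/
theorem chiNext_eq_one {j : ℕ} (χ : CutoffProfile) {c ek pek lamk lam s : ℝ} {d : ℕ} (X : Finset (Balaban1983to89.Site P j))
    {v : Balaban1983to89.Plaq P j → ℂ} {ψ : Balaban1983to89.Site P j → ℂ} {ubar : PBond P j → ℂ}
    (h1 : 0 < c * ek * pek) (h2 : 0 < c * pek * lamk ^ (-(1 / 4 : ℝ))) (h3 : 0 < c * pek * s⁻¹) (h4 : 0 < c * pek)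
    (hv : ∀ p ∈ starP X, ‖v p - 1‖ ≤ 9 / 10 * (c * ek * pek))
    (hψ : s ^ d < lam → ∀ y ∈ X, ‖ψ y‖ ≤ 9 / 10 * (c * pek * lamk ^ (-(1 / 4 : ℝ))))
    (hψ' : ¬ s ^ d < lam → ∀ y ∈ X, |‖ψ y‖ - (8 * lam) ^ (-(1 / 2 : ℝ)) * s ^ (((d : ℝ) - 2) / 2)| ≤ 9 / 10 * (c * pek * s⁻¹))
    (hD : ∀ b ∈ starB X, ‖covD 1 ubar ψ b‖ ≤ 9 / 10 * (c * pek)) :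
    chiNext χ c ek pek lamk lam s d X v ψ ubar = 1 := by
  unfold chiNext
  rw [Finset.prod_eq_one fun p hp => cutoff_eq_one χ h1 (by rw [abs_norm]; exact hv p hp),
    Finset.prod_eq_one fun b hb => cutoff_eq_one χ h4 (by rw [abs_norm]; exact hD b hb), one_mul, mul_one]
  refine Finset.prod_eq_one fun y hy => ?_
  split_ifs with hs
  · exact cutoff_eq_one χ h2 (by rw [abs_norm]; exact hψ hs y hy)
  · exact cutoff_eq_one χ h3 (hψ' hs y hy)

/-- **(5.9.1) ⇒ the argument of the first inserted factor is within `e_k` times the printed radius.**  (5.9.1) p. 296 reads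
`|(1/(ie_k)) log v(p)| = |f(p)| ≤ cp(e_k)`, `p ∈ Λ₀^{(k)′**}`, i.e. `v(p) = e^{ie_k f(p)}` with `|f(p)| ≤ cp(e_k)`; then `|v(p) − 1| ≤ e_k·cp(e_k)`
(`|e^{iθ} − 1| ≤ |θ|`, Mathlib's `Real.norm_exp_I_mul_ofReal_sub_one_le`) — the radius `ce_kp(e_k)` of the factor `χ(ce_kp(e_k), |v(p) − 1|)` of
`χ_{k+1,Λ₀^{(k)′}}`, up to the generic constant. [cite: BalabanImbrieJaffe1988, (5.9.1) p.296] -/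
theorem norm_v_sub_one_le_of_591 {ek f r : ℝ} (hek : 0 ≤ ek) (hf : |f| ≤ r) :
    ‖Complex.exp (Complex.I * ((ek * f : ℝ) : ℂ)) - 1‖ ≤ ek * r := by
  refine Real.norm_exp_I_mul_ofReal_sub_one_le.trans ?_
  rw [Real.norm_eq_abs, abs_mul, abs_of_nonneg hek]
  exact mul_le_mul_of_nonneg_left hf hek

/-! ## §2 The inserted factor of record, read on the configurations of the (5.9.6) frame -/

section Reading

variable {ι : Type*}

variable (P k ι) in
/-- **The data the printed inserted functions take**, per term: the regions `Λ₀^{(k)′}` (block lattice) and `Λ₇^{(k)}` (unit lattice), the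
constants `c, e_k, p(e_k), λ_k, λ, L^kε` of (5.9.2)–(5.9.5), the profile `χ` of (5.2.3), and the readings of the arguments on a configuration
`({u^{(j)}}, u^{(k)}, v)`: the plaquette variables `v(p)`, the bond products `ū_{k+1}` of (4.4) at step `k+1` (in `D_{ū_{k+1}}ψ`), and
`A^{(k)}_b` (*"u′_b = e^{ie_kA′_b}"*, p. 280). [cite: BalabanImbrieJaffe1988, (5.9.5) p.297] -/
structure InsertionReading where
  /-- `Λ₀^{(k)′}` of the term (sites of the `L`-lattice) -/
  Λ0' : ι → Finset (Balaban1983to89.Site P (k+1))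
  /-- `Λ₇^{(k)}` of the term (sites of the unit lattice) -/
  Λ7 : ι → Finset (Balaban1983to89.Site P k)
  /-- the profile `χ` of (5.2.3) -/
  χ : CutoffProfile
  /-- the constants `c`, `e_k`, `p(e_k)`, `λ_k`, `λ`, `L^kε` -/
  (c ek pek lamk lam s : ℝ)
  /-- `v(p)`, read -/
  rv : GaugeField P (k+1) U1 → Balaban1983to89.Plaq P (k+1) → ℂ
  /-- `ū_{k+1}`, read (a function of the term's data and the configuration) -/
  rubar : ι → Prev P k → GaugeField P k U1 → GaugeField P (k+1) U1 → PBond P (k+1) → ℂ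
  /-- `A^{(k)}`, read -/
  rA : GaugeField P k U1 → PBond P k → ℝ

variable (R : InsertionReading P k ι)

/-- **THE INSERTED FACTOR OF RECORD** `χ_ins := χ_{k+1,Λ₀^{(k)′}} · χ′_{Λ₇^{(k)}}` — r16's `chiNext · chiPrime7` at the read arguments `(v(p), ψ,
ū_{k+1}; A^{(k)}, φ^{(k)})`. [cite: BalabanImbrieJaffe1988, (5.9.5) p.297] -/
def chiIns : Entry P k ι ℝ := fun t prev u' v φ ψ =>
  chiNext R.χ R.c R.ek R.pek R.lamk R.lam R.s P.d (R.Λ0' t) (R.rv v) ψ (R.rubar t prev u' v) *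
    chiPrime7 R.χ R.c R.pek (R.Λ7 t) (R.rA u') φ

variable {terms : Finset ι}

/-- **`χ_ins = 1` at a configuration obeying the five printed bounds strictly inside the plateaux** (`chiNext_eq_one` + r16's
`chiPrime7_eq_one`). [cite: BalabanImbrieJaffe1988, (5.9.5) p.297] -/
theorem chiIns_eq_one (hpos : 0 < R.c * R.ek * R.pek ∧ 0 < R.c * R.pek * R.lamk ^ (-(1 / 4 : ℝ)) ∧ 0 < R.c * R.pek * R.s⁻¹ ∧ 0 < R.c * R.pek)
    {t : ι} {prev : Prev P k} {u' : GaugeField P k U1} {v : GaugeField P (k+1) U1} {φ : HiggsField P k} {ψ : HiggsField P (k+1)}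
    (hv : ∀ p ∈ starP (R.Λ0' t), ‖R.rv v p - 1‖ ≤ 9 / 10 * (R.c * R.ek * R.pek))
    (hψ : R.s ^ P.d < R.lam → ∀ y ∈ R.Λ0' t, ‖ψ y‖ ≤ 9 / 10 * (R.c * R.pek * R.lamk ^ (-(1 / 4 : ℝ))))
    (hψ' : ¬ R.s ^ P.d < R.lam → ∀ y ∈ R.Λ0' t,
      |‖ψ y‖ - (8 * R.lam) ^ (-(1 / 2 : ℝ)) * R.s ^ (((P.d : ℝ) - 2) / 2)| ≤ 9 / 10 * (R.c * R.pek * R.s⁻¹))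
    (hD : ∀ b ∈ starB (R.Λ0' t), ‖covD 1 (R.rubar t prev u' v) ψ b‖ ≤ 9 / 10 * (R.c * R.pek))
    (hA : ∀ b ∈ starB (R.Λ7 t), |R.rA u' b| ≤ 9 / 10 * (R.c * R.pek))
    (hφ : ∀ x ∈ R.Λ7 t, ‖φ x‖ ≤ 9 / 10 * (R.c * R.pek)) :
    chiIns R t prev u' v φ ψ = 1 := by
  rw [chiIns, chiNext_eq_one R.χ (R.Λ0' t) hpos.1 hpos.2.1 hpos.2.2.1 hpos.2.2.2 hv hψ hψ' hD,
    chiPrime7_eq_one R.χ hpos.2.2.2 (R.Λ7 t) hA hφ, one_mul]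

end Reading

/-! ## §3 `hins` from the printed bounds on the support -/

section Ins

variable {ι : Type*} {terms : Finset ι} (R : InsertionReading P k ι)

/-- **SECTOR (C), second half — `hins` of `BIJ88Eq596Sectors.h59_of_sectors` FROM THE PRINTED BOUNDS.**  If on the support of the (5.2.8)
characteristic functions `ζχ·χ_k` (read at the original variables `(uOrig, phiOrig, psiOrig)`, axial gauge) the bounds (5.9.1) (as
`|v(p) − 1| ≤ (9/10)ce_kp(e_k)` on `Λ₀^{(k)′**}`), (5.9.2) (on `Λ₀^{(k)′}`, both regimes), (5.9.3) (`|(D_{ū_{k+1}}ψ)(b)| ≤ (9/10)cp(e_k)` on `Λ₀^{(k)′*}`),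
(5.9.4) (`|A^{(k)}_b| ≤ (9/10)cp(e_k)` on `Λ₇^{(k)*}`), (5.9.5) (`|φ^{(k)}(x)| ≤ (9/10)cp(e_k)` on `Λ₇^{(k)}`) hold — *"These bounds allow us to insert …
without changing anything"* — then the inserted factor of record `χ_ins` is `1` there. [cite: BalabanImbrieJaffe1988, (5.9.5) p.297] -/
theorem hins_of_bounds (T : ι → Term41 P k) (w : ι → Prev P k → GaugeField P k U1 → HiggsField P k → HiggsField P (k+1) → ℝ)
    (Λ : ι → Finset (PBond P (k+1))) (s : ι → GaugeField P (k+1) U1 → GaugeField P k U1)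
    (lamφ : ι → Prev P k → GaugeField P k U1 → GaugeField P (k+1) U1 → GaugeTransf P k U1)
    (lamψ : ι → Prev P k → GaugeField P k U1 → GaugeField P (k+1) U1 → GaugeTransf P (k+1) U1)
    (c : ι → Prev P k → GaugeField P k U1 → GaugeField P (k+1) U1 → HiggsField P (k+1) → HiggsField P k)
    (hpos : 0 < R.c * R.ek * R.pek ∧ 0 < R.c * R.pek * R.lamk ^ (-(1 / 4 : ℝ)) ∧ 0 < R.c * R.pek * R.s⁻¹ ∧ 0 < R.c * R.pek)
    (hbounds : ∀ t ∈ terms, ∀ prev u' v φ ψ, DeltaAx u' →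
      w t prev (uOrig Λ s t u' v) (phiOrig Λ s lamφ c t prev u' v φ ψ) (psiOrig Λ s lamψ t prev u' v ψ) *
        (T t).chi prev (cfg (uOrig Λ s t u' v)) (phiOrig Λ s lamφ c t prev u' v φ ψ) ≠ 0 →
      (∀ p ∈ starP (R.Λ0' t), ‖R.rv v p - 1‖ ≤ 9 / 10 * (R.c * R.ek * R.pek)) ∧
      (R.s ^ P.d < R.lam → ∀ y ∈ R.Λ0' t, ‖ψ y‖ ≤ 9 / 10 * (R.c * R.pek * R.lamk ^ (-(1 / 4 : ℝ)))) ∧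
      (¬ R.s ^ P.d < R.lam → ∀ y ∈ R.Λ0' t,
        |‖ψ y‖ - (8 * R.lam) ^ (-(1 / 2 : ℝ)) * R.s ^ (((P.d : ℝ) - 2) / 2)| ≤ 9 / 10 * (R.c * R.pek * R.s⁻¹)) ∧
      (∀ b ∈ starB (R.Λ0' t), ‖covD 1 (R.rubar t prev u' v) ψ b‖ ≤ 9 / 10 * (R.c * R.pek)) ∧
      (∀ b ∈ starB (R.Λ7 t), |R.rA u' b| ≤ 9 / 10 * (R.c * R.pek)) ∧
      (∀ x ∈ R.Λ7 t, ‖φ x‖ ≤ 9 / 10 * (R.c * R.pek))) :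
    ∀ t ∈ terms, ∀ prev u' v φ ψ, DeltaAx u' →
      w t prev (uOrig Λ s t u' v) (phiOrig Λ s lamφ c t prev u' v φ ψ) (psiOrig Λ s lamψ t prev u' v ψ) *
        (T t).chi prev (cfg (uOrig Λ s t u' v)) (phiOrig Λ s lamφ c t prev u' v φ ψ) ≠ 0 → chiIns R t prev u' v φ ψ = 1 := by
  intro t ht prev u' v φ ψ hax hne
  obtain ⟨hv, hψ, hψ', hD, hA, hφ⟩ := hbounds t ht prev u' v φ ψ hax hne
  exact chiIns_eq_one R hpos hv hψ hψ' hD hA hφ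

end Ins

/-! ## §4 `hchars` from the split of `χ_k` and the third sentence -/

section Chars

variable {ι : Type*} {terms : Finset ι}

/-- **THE (5.9.6) ENTRY `chars` OF RECORD**: `ζ_{Λ₀ᶜ}χ_{Λ₀} · χ_{k,Λ₀^{(k−1)′}∩Λ₁^{(k)c}} · χ_{k+1,Λ₀^{(k)′}}χ′_{Λ₇^{(k)}}` — the (5.2.7) weight `ζχ` (`w`) and the
`Λ₁^{(k)c}`-part `χ_out` of the (4.1) characteristic function read at the original variables, times the inserted factor `χ_ins`.
[cite: BalabanImbrieJaffe1988, (5.9.6) p.297] -/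
def charsNew (w : ι → Prev P k → GaugeField P k U1 → HiggsField P k → HiggsField P (k+1) → ℝ)
    (chiOut : ι → Prev P k → (PBond P k → ℂ) → HiggsField P k → ℝ) (χins : Entry P k ι ℝ)
    (Λ : ι → Finset (PBond P (k+1))) (s : ι → GaugeField P (k+1) U1 → GaugeField P k U1)
    (lamφ : ι → Prev P k → GaugeField P k U1 → GaugeField P (k+1) U1 → GaugeTransf P k U1)
    (lamψ : ι → Prev P k → GaugeField P k U1 → GaugeField P (k+1) U1 → GaugeTransf P (k+1) U1)
    (c : ι → Prev P k → GaugeField P k U1 → GaugeField P (k+1) U1 → HiggsField P (k+1) → HiggsField P k) : Entry P k ι ℝ :=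
  fun t prev u' v φ ψ =>
    w t prev (uOrig Λ s t u' v) (phiOrig Λ s lamφ c t prev u' v φ ψ) (psiOrig Λ s lamψ t prev u' v ψ) *
      chiOut t prev (cfg (uOrig Λ s t u' v)) (phiOrig Λ s lamφ c t prev u' v φ ψ) * χins t prev u' v φ ψ

/-- **SECTOR (C), first half — `hchars` of `BIJ88Eq596Sectors.h59_of_sectors` FROM THE SPLIT OF `χ_k` AND THE THIRD SENTENCE.**  If the (4.1)
characteristic function of the term splits as `χ_{k,Λ₀^{(k−1)′}} = χ_{k,·∩Λ₁^{(k)}} · χ_{k,·∩Λ₁^{(k)c}}` (`hsplit`, a reading of the product (4.5)) and the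
`Λ₁^{(k)}`-part is `1` wherever `ζ_{Λ₀ᶜ}χ_{Λ₀} ≠ 0` (`hstrong`: *"the restrictions implied by χ_{Λ₀^{(k)}} are stronger than the corresponding
restrictions in χ_{k,Λ₀^{(k−1)′}} in Λ₁^{(k)}. … Thus we can replace χ_{k,Λ₀^{(k−1)′}} with χ_{k,Λ₀^{(k−1)′}∩Λ₁^{(k)c}} without changing anything"*), then for the
entry of record `charsNew` the hypothesis `hchars` holds: `chars = ζχ·χ_k·χ_ins`. [cite: BalabanImbrieJaffe1988, (5.9.6) p.297] -/
theorem hchars_of_split (T : ι → Term41 P k) (w : ι → Prev P k → GaugeField P k U1 → HiggsField P k → HiggsField P (k+1) → ℝ)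
    (chiIn chiOut : ι → Prev P k → (PBond P k → ℂ) → HiggsField P k → ℝ) (χins : Entry P k ι ℝ)
    (Λ : ι → Finset (PBond P (k+1))) (s : ι → GaugeField P (k+1) U1 → GaugeField P k U1)
    (lamφ : ι → Prev P k → GaugeField P k U1 → GaugeField P (k+1) U1 → GaugeTransf P k U1)
    (lamψ : ι → Prev P k → GaugeField P k U1 → GaugeField P (k+1) U1 → GaugeTransf P (k+1) U1)
    (c : ι → Prev P k → GaugeField P k U1 → GaugeField P (k+1) U1 → HiggsField P (k+1) → HiggsField P k)
    (hsplit : ∀ t ∈ terms, ∀ prev u φ, (T t).chi prev u φ = chiIn t prev u φ * chiOut t prev u φ)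
    (hstrong : ∀ t ∈ terms, ∀ prev u' v φ ψ, DeltaAx u' →
      w t prev (uOrig Λ s t u' v) (phiOrig Λ s lamφ c t prev u' v φ ψ) (psiOrig Λ s lamψ t prev u' v ψ) ≠ 0 →
        chiIn t prev (cfg (uOrig Λ s t u' v)) (phiOrig Λ s lamφ c t prev u' v φ ψ) = 1)
    (D : Bracket596 P k ι) (hD : D.chars = charsNew w chiOut χins Λ s lamφ lamψ c) :
    ∀ t ∈ terms, ∀ prev u' v φ ψ, DeltaAx u' → D.chars t prev u' v φ ψ =
      w t prev (uOrig Λ s t u' v) (phiOrig Λ s lamφ c t prev u' v φ ψ) (psiOrig Λ s lamψ t prev u' v ψ) *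
        (T t).chi prev (cfg (uOrig Λ s t u' v)) (phiOrig Λ s lamφ c t prev u' v φ ψ) * χins t prev u' v φ ψ := by
  intro t ht prev u' v φ ψ hax
  rw [hD, charsNew, hsplit t ht]
  by_cases hw : w t prev (uOrig Λ s t u' v) (phiOrig Λ s lamφ c t prev u' v φ ψ) (psiOrig Λ s lamψ t prev u' v ψ) = 0
  · simp only [hw, zero_mul]
  · rw [hstrong t ht prev u' v φ ψ hax hw, one_mul]

end Chars

/-! ## §5 (5.9.6) at measure level with the sector (C) carried by the printed bounds -/

section Assembly

variable {ι : Type*} {terms : Finset ι} {ρL : GaugeField P (k+1) U1 → HiggsField P (k+1) → ℂ} (R : InsertionReading P k ι)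

/-- **(5.9.6) AT MEASURE LEVEL, SECTOR (C) FROM THE PRINTED BOUNDS** — `BIJ88Eq596Sectors.eq596_of_sectors_filled` with the inserted factor of
record `χ_ins := chiIns R` (so the entry `chars` of the table is `ζχ·χ_k·χ_{k+1,Λ₀′}χ′_{Λ₇}` read at the original variables) and `hins`
DISCHARGED by `hins_of_bounds`: hypotheses = the (5.2.8) input with integrable brackets, the p. 282 phases, the p. 284 δ-claims, the (5.8.1)
shifts (as in `eq596_printed`), the displayed sector identities (Z) `hZ`, (G) `hG`, (S) `hS` (fed by name modulo readings in
`BIJ88Eq596SlotsByName`), positivity of the radii, and the five printed bounds (5.9.1)–(5.9.5) on the support of `ζχ·χ_k`.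
[cite: BalabanImbrieJaffe1988, (5.9.6) p.297] -/
theorem eq596_of_sectors_ins (D : Bracket596 P k ι) (T : ι → Term41 P k)
    (w : ι → Prev P k → GaugeField P k U1 → HiggsField P k → HiggsField P (k+1) → ℝ) (a : ℝ)
    (Qφ : ι → Prev P k → GaugeField P k U1 → HiggsField P k → HiggsField P (k+1))
    (hk : k + 1 ≤ P.m + P.K) (h528 : IsRD (axialMeasure P k U1) terms qU Qφ a (rho528 w T) ρL)
    (hρi : ∀ t ∈ terms, Integrable
      (fun q : Fields P k => rho528 w T t q.2.1 q.1 q.2.2.1 q.2.2.2 * (gaussWeight a (Qφ t q.2.1 q.1 q.2.2.1) q.2.2.2 : ℂ))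
      (fieldsMeasure (axialMeasure P k U1)))
    (Λ : ι → Finset (PBond P (k+1)))
    (lamφ : ι → Prev P k → GaugeField P k U1 → GaugeField P (k+1) U1 → GaugeTransf P k U1)
    (lamψ : ι → Prev P k → GaugeField P k U1 → GaugeField P (k+1) U1 → GaugeTransf P (k+1) U1)
    (hmφ : ∀ t ∈ terms, Measurable fun x : GaugeField P k U1 × Prev P k => lamφ t x.2 (uCut qU (Λ t) x.1) (qU x.1))
    (hmψ : ∀ t ∈ terms, Measurable fun x : GaugeField P k U1 × Prev P k => lamψ t x.2 (uCut qU (Λ t) x.1) (qU x.1))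
    (s : ι → GaugeField P (k+1) U1 → GaugeField P k U1) (hs : ∀ t ∈ terms, ∀ w, ∀ b ∈ (axialBonds : Finset (PBond P k)), s t w b = 1)
    (S : ι → Set (GaugeField P k U1))
    (hsupp : ∀ t ∈ terms, ∀ prev u' v φ ψ, renamedBracket Qφ a (rho528 w T) Λ lamφ lamψ t prev u' v φ ψ ≠ 0 → u' ∈ S t)
    (hQS : ∀ t ∈ terms, ∀ u' ∈ S t, ∀ w, qU (bondMul u' (s t w)) = qU u' ∧ qU (bondMul u' fun b => (s t w b)⁻¹) = qU u')
    (c : ι → Prev P k → GaugeField P k U1 → GaugeField P (k+1) U1 → HiggsField P (k+1) → HiggsField P k)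
    (hpos : 0 < R.c * R.ek * R.pek ∧ 0 < R.c * R.pek * R.lamk ^ (-(1 / 4 : ℝ)) ∧ 0 < R.c * R.pek * R.s⁻¹ ∧ 0 < R.c * R.pek)
    (hbounds : ∀ t ∈ terms, ∀ prev u' v φ ψ, DeltaAx u' →
      w t prev (uOrig Λ s t u' v) (phiOrig Λ s lamφ c t prev u' v φ ψ) (psiOrig Λ s lamψ t prev u' v ψ) *
        (T t).chi prev (cfg (uOrig Λ s t u' v)) (phiOrig Λ s lamφ c t prev u' v φ ψ) ≠ 0 →
      (∀ p ∈ starP (R.Λ0' t), ‖R.rv v p - 1‖ ≤ 9 / 10 * (R.c * R.ek * R.pek)) ∧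
      (R.s ^ P.d < R.lam → ∀ y ∈ R.Λ0' t, ‖ψ y‖ ≤ 9 / 10 * (R.c * R.pek * R.lamk ^ (-(1 / 4 : ℝ)))) ∧
      (¬ R.s ^ P.d < R.lam → ∀ y ∈ R.Λ0' t,
        |‖ψ y‖ - (8 * R.lam) ^ (-(1 / 2 : ℝ)) * R.s ^ (((P.d : ℝ) - 2) / 2)| ≤ 9 / 10 * (R.c * R.pek * R.s⁻¹)) ∧
      (∀ b ∈ starB (R.Λ0' t), ‖covD 1 (R.rubar t prev u' v) ψ b‖ ≤ 9 / 10 * (R.c * R.pek)) ∧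
      (∀ b ∈ starB (R.Λ7 t), |R.rA u' b| ≤ 9 / 10 * (R.c * R.pek)) ∧
      (∀ x ∈ R.Λ7 t, ‖φ x‖ ≤ 9 / 10 * (R.c * R.pek)))
    (hZ : ∀ t ∈ terms, ∀ prev u' v φ ψ, DeltaAx u' →
      (∏ j, (T t).Zv j * (T t).Zs j ((T t).uk prev (cfg (uOrig Λ s t u' v)))) =
        D.zf t prev u' v φ ψ * Real.exp (-(D.Qk t prev u' v φ ψ + D.W2 t prev u' v φ ψ)))
    (hG : ∀ t ∈ terms, ∀ prev u' v φ ψ, DeltaAx u' →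
      (1 / 2 : ℝ) * gaugeForm (T t) (cfg (uOrig Λ s t u' v)) =
        D.Q1 t prev u' v φ ψ + D.quadA t prev u' v φ ψ / 2 + D.quadF t prev u' v φ ψ / 2 + D.Q2 t prev u' v φ ψ + D.Q3 t prev u' v φ ψ
          + D.fw3A t prev u' v φ ψ + D.fw4f t prev u' v φ ψ / 2)
    (hS : ∀ t ∈ terms, ∀ prev u' v φ ψ, DeltaAx u' →
      gaussQuad a (Qφ t prev (uOrig Λ s t u' v) (phiOrig Λ s lamφ c t prev u' v φ ψ)) (psiOrig Λ s lamψ t prev u' v ψ)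
        + (1 / 2 : ℝ) * scalarForm (T t) ((T t).uk prev (cfg (uOrig Λ s t u' v))) (phiOrig Λ s lamφ c t prev u' v φ ψ)
        + (T t).Ploc prev (cfg (uOrig Λ s t u' v)) (phiOrig Λ s lamφ c t prev u' v φ ψ) =
        D.Q4 t prev u' v φ ψ + D.Q5 t prev u' v φ ψ + D.Q6 t prev u' v φ ψ + D.quadPhi t prev u' v φ ψ / 2
          + D.quadPsi t prev u' v φ ψ / 2 + D.phiW6Psi t prev u' v φ ψ + D.psiW7Psi t prev u' v φ ψ / 2
          + D.Pkloc t prev u' v φ ψ + D.Rk t prev u' v φ ψ + D.W1 t prev u' v φ ψ) :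
    IsDT (axialMeasure P k U1) terms Λ qU (bracket596 (fill41 D T w a Λ s lamφ lamψ c (chiIns R)))
        (rho596 terms Λ (renamedBracket Qφ a (rho528 w T) Λ lamφ lamψ)) ∧
      ∫ v, ∫ ψ, rho596 terms Λ (renamedBracket Qφ a (rho528 w T) Λ lamφ lamψ) v ψ ∂volume ∂fieldMeasure P (k+1) U1 =
        ∫ v, ∫ ψ, ρL v ψ ∂volume ∂fieldMeasure P (k+1) U1 :=
  eq596_of_sectors_filled D T w a Qφ hk h528 hρi Λ lamφ lamψ hmφ hmψ s hs S hsupp hQS c (chiIns R)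
    (hins_of_bounds R T w Λ s lamφ lamψ c hpos hbounds) hZ hG hS

end Assembly

end

end Literature.MathematicalPhysics.QuantumFieldTheory.BalabanImbrieJaffe1984to88.BIJ88Eq596Insertions
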